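import Literature.Barriers.PneNP.TSPExtensionComplexityRothvossCounts
import Mathlib.Algebra.Order.Field.Basic
import HarnessLib

/-!
# Rothvoß's Lemma 7, the contribution of GOOD pairs (§§3.3–3.4) in sample-space form

Support file for the discharge of `Literature.Barriers.PneNP.Rothvoss2017_tsp` along the route
of `…RothvossBridge.lean` (target: `|Ω_3 ∩ R|/|Ω_3| ≤ (400/k²)|Ω_k ∩ R|/|Ω_k| + 2^{-δm}`). Rothvoß
splits `μ_3(R) = E_T E_H[p^ex_M p^ex_U]` according to whether the pair `(T, H)` is GOOD, SMALL or
BAD (§3.3, PDF p. 9) and bounds the good part by `(200/k²) μ_k(R)` (§3.4, PDF p. 10: Lemma 8,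
Lemma 9 "`Pr_{H ∼ binom(F,3)}[GOOD(T,H)] ≤ 100/k²`", and the three-line computation). Here, with
the sample spaces `Ω_r` of compatible triples `(T, U, M)`:

* `card_OmegaR_filter_eq_sum` — `|{ω ∈ Ω_r ∩ R : P(T, H)}| = Σ_T Σ_{H : P} |X ∩ U^ex(T,H)| · |Y ∩ M^ex(T,H)|`
  (the decomposition of the sample space by `(T, H)`);
* the goodness notions in COUNT form (`Ncnt`, `pmCDsup`, `MGoodΩ`, `UGoodΩ`, `SmallΩ`, `GoodΩ`;
  equivalent to the printed ratio form because the normalisations `|{M ∈ M_all(T) : F' ⊆ M}| = w_T`,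
  `|U^ex(T,H)| = |U^ex(T,C)| = C(m,(m+1)/2)` are constants, `…RothvossCounts.lean`);
* `card_inter_Mext_le` — Lemma 8 in count form: for `M`-good `(T,H)` and a `k`-matching `F ⊇ H`,
  `|Y ∩ M^ex(T,H)| ≤ (1+ε)² P(k-3)² |Y ∩ M^ex(T,F)|`;
* `card_filter_three_subsets_le` (two good `3`-subsets of `F` share two edges ⟹ at most
  `3(k-3)+1` good ones) and `card_good_subsets_le` — Lemma 9, from "`R` avoids `Q_1`";
* `good_sum_le` — per partition: `c₁ Σ_{H good} term_3(H) ≤ (1+ε)³ P(k-3)² (3(k-3)+1) Σ_F term_k(F)`;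
* `card_OmegaR_good_mul_le` — summed: `|Ω_3^{good} ∩ R| · |Ω_k| ≤ (1+ε)³ ((3k-8)/C(k,3)) |Ω_k ∩ R| · |Ω_3|`.

Sources: [Rothvoss2017] §3.3 (PDF p. 9: Definitions 1–2, Lemma 8, "small", "bad"), §3.4 (PDF
p. 10: Lemma 9 and the bound `(200/k²) μ_k(R)`).
-/

noncomputable section

namespace Literature.Barriers.PneNP

open Finset Literature.Combinatorics.SimpleGraph.CycleSpace Lbl

variable {n m k : ℕ}

/-! ### Decomposing the sample space by `(T, H)` -/

section Decompose

variable (t r : ℕ) (X : Finset (Finset (Fin n))) (Y : Finset (Finset (Sym2 (Fin n))))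

/-- The number of outcomes `(U, M) ∈ X × Y` of the sampler given `(T, H)`:
`|X ∩ U^ex(T,H)| · |Y ∩ M^ex(T,H)|` ( `= u w · p^ex_U(H) p^ex_M(H)`). [cite: Rothvoss2017, §3.2 (PDF p. 9)] -/
def termN (lab : Fin n → Lbl m) (H : Finset (Sym2 (Fin n))) : ℕ :=
  (X ∩ Uext lab t H).card * (Y ∩ Mext lab H).card

/-- The fibre of `Ω_r ∩ R` over `(T, H)` has `termN` elements. [folklore] -/
theorem card_fiber_OmegaR {lab : Fin n → Lbl m} {H : Finset (Sym2 (Fin n))}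
    (hlab : lab ∈ partitions n m k) (hH : H ∈ cdMatchings lab r) :
    ((OmegaR n m k t r X Y).filter fun ω => ω.1 = lab ∧ ω.2.2.filter (IsCD ω.1) = H).card =
      termN t X Y lab H := by
  classical
  rw [termN, ← card_product]
  refine (card_nbij' (fun ω => (ω.2.1, ω.2.2)) (fun p => (lab, p.1, p.2)) (fun ω hω => ?_)
    (fun p hp => ?_) (fun ω hω => ?_) (fun p hp => ?_))
  · rw [mem_coe, mem_filter, OmegaR, mem_filter] at hω
    obtain ⟨⟨hΩ, hX, hY⟩, rfl, hHeq⟩ := hω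
    obtain ⟨-, -, hU, hM⟩ := mem_Omega_iff.1 hΩ
    rw [hHeq] at hU hM
    rw [mem_coe, mem_product, mem_inter, mem_inter]
    exact ⟨⟨hX, hU⟩, ⟨hY, hM⟩⟩
  · rw [mem_coe, mem_product, mem_inter, mem_inter] at hp
    obtain ⟨⟨hX, hU⟩, ⟨hY, hM⟩⟩ := hp
    have hMH : p.2.filter (IsCD lab) = H := (mem_Mext_iff.1 hM).2
    rw [mem_coe, mem_filter, OmegaR, mem_filter]
    exact ⟨⟨mk_mem_Omega hlab hH hU hM, hX, hY⟩, rfl, hMH⟩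
  · rw [mem_coe, mem_filter] at hω
    obtain ⟨-, h1, -⟩ := hω
    rcases ω with ⟨lab', U, M⟩
    simp only at h1
    subst h1
    rfl
  · rfl

/-- The pairs `(T, H)` indexing the fibres. [folklore] -/
def THpairs (r : ℕ) : Finset ((Fin n → Lbl m) × Finset (Sym2 (Fin n))) :=
  (partitions n m k).biUnion fun lab => (cdMatchings lab r).image fun H => (lab, H)

/-- Sums over `THpairs` are iterated sums. [folklore] -/
theorem sum_THpairs (f : (Fin n → Lbl m) → Finset (Sym2 (Fin n)) → ℕ) :
    ∑ p ∈ THpairs (n := n) (m := m) (k := k) r, f p.1 p.2 =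
      ∑ lab ∈ partitions n m k, ∑ H ∈ cdMatchings lab r, f lab H := by
  classical
  rw [THpairs, sum_biUnion]
  · refine sum_congr rfl fun lab _ => ?_
    rw [sum_image]
    exact fun H _ H' _ h => (Prod.mk.inj h).2
  · intro lab _ lab' _ hne
    rw [Function.onFun, disjoint_left]
    intro p hp hp'
    obtain ⟨H, -, rfl⟩ := mem_image.1 hp
    obtain ⟨H', -, hp'⟩ := mem_image.1 hp'
    exact hne (Prod.mk.inj hp').1.symm

/-- **Decomposition of the sample space by `(T, H)`**: for any property `P` of the pair
`(T, H)`, the outcomes of `Ω_r` inside `R = X × Y` whose `(T, H)` satisfies `P` number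
`Σ_T Σ_{H ∈ cdM_r(T), P(T,H)} |X ∩ U^ex(T,H)| · |Y ∩ M^ex(T,H)|`. [cite: Rothvoss2017, §3.2–3.3 (PDF p. 9)] -/
theorem card_OmegaR_filter_eq_sum (P : (Fin n → Lbl m) → Finset (Sym2 (Fin n)) → Prop)
    [∀ lab H, Decidable (P lab H)] :
    ((OmegaR n m k t r X Y).filter fun ω => P ω.1 (ω.2.2.filter (IsCD ω.1))).card =
      ∑ lab ∈ partitions n m k, ∑ H ∈ (cdMatchings lab r).filter (P lab), termN t X Y lab H := by
  classical
  have hmaps : Set.MapsTo (fun ω : (Fin n → Lbl m) × Finset (Fin n) × Finset (Sym2 (Fin n)) =>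
      (ω.1, ω.2.2.filter (IsCD ω.1)))
      ↑((OmegaR n m k t r X Y).filter fun ω => P ω.1 (ω.2.2.filter (IsCD ω.1)))
      ↑(THpairs (n := n) (m := m) (k := k) r) := by
    intro ω hω
    rw [Finset.mem_coe, mem_filter, OmegaR, mem_filter] at hω
    obtain ⟨⟨hΩ, -, -⟩, -⟩ := hω
    obtain ⟨hlab, hH, -, -⟩ := mem_Omega_iff.1 hΩ
    rw [Finset.mem_coe, THpairs, mem_biUnion]
    exact ⟨ω.1, hlab, mem_image.2 ⟨_, hH, rfl⟩⟩
  rw [card_eq_sum_card_fiberwise hmaps]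
  have := sum_THpairs (n := n) (m := m) (k := k) r (fun lab H =>
    (((OmegaR n m k t r X Y).filter fun ω => P ω.1 (ω.2.2.filter (IsCD ω.1))).filter
      fun ω => (ω.1, ω.2.2.filter (IsCD ω.1)) = (lab, H)).card)
  rw [this]
  refine sum_congr rfl fun lab hlab => ?_
  rw [sum_filter]
  refine sum_congr rfl fun H hH => ?_
  by_cases hP : P lab H
  · rw [if_pos hP, ← card_fiber_OmegaR t r X Y hlab hH]
    congr 1
    ext ω
    simp only [mem_filter, Prod.mk.injEq]
    constructor
    · rintro ⟨⟨hω, -⟩, h1, h2⟩; exact ⟨hω, h1, h2⟩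
    · rintro ⟨hω, h1, h2⟩
      refine ⟨⟨hω, ?_⟩, h1, h2⟩
      rw [h2, h1]; exact hP
  · rw [if_neg hP, card_eq_zero, filter_eq_empty_iff]
    intro ω hω heq
    obtain ⟨h1, h2⟩ := Prod.mk.inj heq
    rw [mem_filter] at hω
    obtain ⟨-, hω⟩ := hω
    rw [h2, h1] at hω
    exact hP hω

/-- Special case `P = True`: `|Ω_r ∩ R| = Σ_T Σ_H termN`. [folklore] -/
theorem card_OmegaR_eq_sum :
    (OmegaR n m k t r X Y).card = ∑ lab ∈ partitions n m k, ∑ H ∈ cdMatchings lab r, termN t X Y lab H := by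
  classical
  have h := card_OmegaR_filter_eq_sum (n := n) (m := m) (k := k) t r X Y (fun _ _ => True)
  rw [filter_true_of_mem (fun _ _ => trivial)] at h
  rw [h]
  refine sum_congr rfl fun lab _ => ?_
  rw [filter_true_of_mem (fun _ _ => trivial)]

end Decompose

/-- `Ω_r` is `Ω_r ∩ R` for the all-inclusive rectangle. [folklore] -/
theorem Omega_eq_OmegaR_univ (t r : ℕ) :
    Omega n m k t r = OmegaR n m k t r (univ : Finset (Finset (Fin n))) (univ : Finset (Finset (Sym2 (Fin n)))) := by
  rw [OmegaR]
  exact (filter_true_of_mem fun ω _ => ⟨mem_univ _, mem_univ _⟩).symm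

/-- `|Ω_r| = Σ_T Σ_H |U^ex(T,H)| · |M^ex(T,H)|`. [cite: Rothvoss2017, §3.2 (PDF p. 9)] -/
theorem card_Omega_eq_sum (t r : ℕ) :
    (Omega n m k t r).card = ∑ lab ∈ partitions n m k, ∑ H ∈ cdMatchings lab r,
      (Uext lab t H).card * (Mext lab H).card := by
  rw [Omega_eq_OmegaR_univ, card_OmegaR_eq_sum]
  refine sum_congr rfl fun lab _ => sum_congr rfl fun H _ => ?_
  simp [termN]

/-! ### The normalisations per partition -/

section Norms

variable {lab : Fin n → Lbl m} {r t : ℕ}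

/-- `P(0) = 1` (the empty matching). [folklore] -/
theorem pmCount_zero : pmCount 0 = 1 := by
  rw [pmCount]
  have h : (univ : Finset (Fin 0)) = ∅ := rfl
  rw [h]
  have : perfectMatchings (∅ : Finset (Fin 0)) = {∅} := by
    ext M
    rw [mem_perfectMatchings, mem_singleton]
    exact ⟨IsPMOn.eq_empty, fun h => h ▸ IsPMOn.empty⟩
  rw [this, card_singleton]

/-- `P(s) > 0` for even `s`. [folklore] -/
theorem pmCount_pos {s : ℕ} (hs : Even s) : 0 < pmCount s := by
  rw [pmCount, card_pos]
  obtain ⟨M, hM⟩ := exists_isPMOn_of_even s (univ : Finset (Fin s)) (by simp) hs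
  exact ⟨M, mem_perfectMatchings.2 hM⟩

/-- **`|M^ex(T, F)| = w_T`** for a `k`-matching `F`. [cite: Rothvoss2017, §3.2 (PDF p. 9)] -/
theorem card_Mext_k (hlab : lab ∈ partitions n m k) {F : Finset (Sym2 (Fin n))} (hF : F ∈ cdMatchings lab k) :
    (Mext lab F).card = wT lab := by
  rw [card_Mext_eq, card_pmCDH hlab hF, Nat.sub_self, pmCount_zero, one_mul, one_mul]

/-- **`|M^ex(T, H)| = P(k-3)² w_T`** for a `3`-matching `H`. [cite: Rothvoss2017, §3.2 (PDF p. 9)] -/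
theorem card_Mext_three (hlab : lab ∈ partitions n m k) {H : Finset (Sym2 (Fin n))} (hH : H ∈ cdMatchings lab 3) :
    (Mext lab H).card = pmCount (k - 3) * pmCount (k - 3) * wT lab := by
  rw [card_Mext_eq, card_pmCDH hlab hH]

/-- **`|U^ex(T, H)| = |U^ex(T, F)|`** at Rothvoß's `t` (`m` odd, `k > 3`): both equal a central
binomial coefficient `C(m, (m+1)/2) = C(m, (m-1)/2)`. [cite: Rothvoss2017, §3.1 (PDF p. 8)] -/
theorem card_Uext_three_eq_k (hlab : lab ∈ partitions n m k) (hk : 3 < k) (hm : m % 2 = 1)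
    {H F : Finset (Sym2 (Fin n))} (hH : H ∈ cdMatchings lab 3) (hF : F ∈ cdMatchings lab k) :
    (Uext lab ((m + 1) / 2 * (k - 3) + 3) H).card = (Uext lab ((m + 1) / 2 * (k - 3) + 3) F).card := by
  rw [card_Uext hlab hH hk (j := (m + 1) / 2) (by ring),
    card_Uext hlab hF hk (j := (m - 1) / 2) ?_]
  · have h1 : (m + 1) / 2 + (m - 1) / 2 = m := by omega
    conv_lhs => rw [← Nat.choose_symm (show (m + 1) / 2 ≤ m by omega)]
    congr 1
    omega
  · have hq : (m + 1) / 2 = (m - 1) / 2 + 1 := by omega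
    rw [hq, add_mul, one_mul, add_assoc, Nat.sub_add_cancel hk.le, add_comm]

end Norms

/-! ### Goodness in count form -/

section Goodness

variable {lab : Fin n → Lbl m} {r t : ℕ}

/-- Two perfect matchings of the same set, one inside the other, are equal. [folklore] -/
theorem IsPMOn.eq_of_subset {V : Type*} [DecidableEq V] {S : Finset V} {F G : Finset (Sym2 V)}
    (hF : IsPMOn S F) (hG : IsPMOn S G) (h : F ⊆ G) : F = G := by
  refine Subset.antisymm h fun e he => ?_
  induction e using Sym2.ind with
  | h a b =>
    have ha : a ∈ S := hG.mem_of_mem he (Sym2.mem_mk_left a b)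
    obtain ⟨f, hf, haf⟩ := hF.exists_mem ha
    rw [← hG.unique (h hf) he haf (Sym2.mem_mk_left a b)]
    exact hf

variable (lab) in
/-- `{M ∈ M_all(T) : F' ⊆ M}`, whose proportion inside `Y` is Rothvoß's `p_{M,T}(F')`.
[cite: Rothvoss2017, §3.2 (PDF p. 9: "p_{M,T}(H) := Pr_{M ∈ 𝓜_all(T)}[M ∈ 𝓜 | H ⊆ M]")] -/
def supM (F' : Finset (Sym2 (Fin n))) : Finset (Finset (Sym2 (Fin n))) :=
  (Mall lab).filter fun M => F' ⊆ M

/-- `N(F') := |Y ∩ {M ∈ M_all(T) : F' ⊆ M}|` (`= w_T · p_{M,T}(F')` for a perfect matching `F'`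
of `C ∪ D`). [cite: Rothvoss2017, §3.2 (PDF p. 9)] -/
def Ncnt (Y : Finset (Finset (Sym2 (Fin n)))) (lab : Fin n → Lbl m) (F' : Finset (Sym2 (Fin n))) : ℕ :=
  (Y ∩ supM lab F').card

variable (lab) in
/-- The perfect matchings of `C ∪ D` containing `H` (the `k`-matchings `F'` with
`H ⊆ F' ⊆ E(C ∪ D)` of Definition 1). [cite: Rothvoss2017, Def. 1 (PDF p. 9)] -/
def pmCDsup (H : Finset (Sym2 (Fin n))) : Finset (Finset (Sym2 (Fin n))) :=
  (perfectMatchings (blkC lab Lbl.C)).filter fun F' => H ⊆ F'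

/-- The average of `N` over `pmCDsup T H` (`= w_T · p_{M,T}(H)`, by Lemma 8's identity).
[cite: Rothvoss2017, Lemma 8 (PDF p. 9)] -/
def Navg (Y : Finset (Finset (Sym2 (Fin n)))) (lab : Fin n → Lbl m) (H : Finset (Sym2 (Fin n))) : ℝ :=
  (∑ F' ∈ pmCDsup lab H, (Ncnt Y lab F' : ℝ)) / (pmCDsup lab H).card

/-- **`M`-goodness** (Definition 1) in count form: `p_{M,T}(F') ∈ [p/(1+ε), (1+ε)p]` for all
`F' ∈ pmCDsup T H`, with `p = p_{M,T}(H) > 0`; counts instead of probabilities (the common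
normalisation `w_T` cancels). [cite: Rothvoss2017, Def. 1 (PDF p. 9)] -/
def MGoodΩ (Y : Finset (Finset (Sym2 (Fin n)))) (lab : Fin n → Lbl m) (H : Finset (Sym2 (Fin n))) (ε : ℝ) : Prop :=
  0 < Navg Y lab H ∧ ∀ F' ∈ pmCDsup lab H,
    Navg Y lab H / (1 + ε) ≤ Ncnt Y lab F' ∧ (Ncnt Y lab F' : ℝ) ≤ (1 + ε) * Navg Y lab H

variable (lab t) in
/-- `U^ex_all(T, C) = {U ∈ U_all(T) : C ⊆ U}`. [cite: Rothvoss2017, Def. 2 (PDF p. 9: "p^ex_{U,T}(C)")] -/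
def UextC : Finset (Finset (Fin n)) := (Uall lab t).filter fun U => lblk lab Lbl.C ⊆ U

/-- **`U`-goodness** (Definition 2) in count form: `p^ex_{U,T}(C) ∈ [p/(1+ε), (1+ε)p]` with
`p = p^ex_{U,T}(H) > 0`; counts instead of probabilities (the normalisations
`|U^ex(T,H)| = |U^ex(T,C)|` agree, `card_Uext_three_eq_k`). [cite: Rothvoss2017, Def. 2 (PDF p. 9)] -/
def UGoodΩ (X : Finset (Finset (Fin n))) (lab : Fin n → Lbl m) (t : ℕ) (H : Finset (Sym2 (Fin n))) (ε : ℝ) : Prop :=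
  0 < (X ∩ Uext lab t H).card ∧
    ((X ∩ Uext lab t H).card : ℝ) ≤ (1 + ε) * (X ∩ UextC lab t).card ∧
    ((X ∩ UextC lab t).card : ℝ) ≤ (1 + ε) * (X ∩ Uext lab t H).card

/-- **Small pairs** (suffix `Ω`: the sample-space versions of this file; the slot-model file `…RothvossCore.lean` has its own `Small`/`Good`): `p^ex_{M,T}(H) ≤ θ` or `p^ex_{U,T}(H) ≤ θ` (`θ = 2^{-δm}`), in count form.
[cite: Rothvoss2017, §3.3 (PDF p. 9: "small")] -/
def SmallΩ (X : Finset (Finset (Fin n))) (Y : Finset (Finset (Sym2 (Fin n)))) (lab : Fin n → Lbl m)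
    (t : ℕ) (H : Finset (Sym2 (Fin n))) (θ : ℝ) : Prop :=
  ((Y ∩ Mext lab H).card : ℝ) ≤ θ * (Mext lab H).card ∨
    ((X ∩ Uext lab t H).card : ℝ) ≤ θ * (Uext lab t H).card

/-- **Good pairs** = `M`-good and `U`-good. [cite: Rothvoss2017, §3.3 (PDF p. 9)] -/
def GoodΩ (X : Finset (Finset (Fin n))) (Y : Finset (Finset (Sym2 (Fin n)))) (lab : Fin n → Lbl m)
    (t : ℕ) (H : Finset (Sym2 (Fin n))) (ε : ℝ) : Prop :=
  MGoodΩ Y lab H ε ∧ UGoodΩ X lab t H ε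

/-- Goodness is decidable (classically). [folklore] -/
instance (X : Finset (Finset (Fin n))) (Y : Finset (Finset (Sym2 (Fin n)))) (lab : Fin n → Lbl m)
    (t : ℕ) (H : Finset (Sym2 (Fin n))) (ε : ℝ) : Decidable (GoodΩ X Y lab t H ε) := Classical.dec _

/-- Smallness is decidable (classically). [folklore] -/
instance (X : Finset (Finset (Fin n))) (Y : Finset (Finset (Sym2 (Fin n)))) (lab : Fin n → Lbl m)
    (t : ℕ) (H : Finset (Sym2 (Fin n))) (θ : ℝ) : Decidable (SmallΩ X Y lab t H θ) := Classical.dec _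

/-! #### The restricted block product once more -/

/-- **`|{M ∈ M_all(T) : M ∩ E(C ∪ D) ∈ 𝒢}| = |𝒢| · w_T`** for any family `𝒢` of perfect matchings
of `C ∪ D`. [cite: Rothvoss2017, proof of Lemma 15 (PDF p. 12)] -/
theorem card_Mall_restrictC (lab : Fin n → Lbl m) (𝒢C : Finset (Finset (Sym2 (Fin n))))
    (h𝒢C : 𝒢C ⊆ perfectMatchings (blkC lab Lbl.C)) :
    ((Mall lab).filter fun M => (M.filter fun e => e ∈ (blkC lab Lbl.C).sym2) ∈ 𝒢C).card =
      𝒢C.card * wT lab := by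
  let 𝒢 : Lbl m → Finset (Finset (Sym2 (Fin n))) :=
    fun c => if c = Lbl.C then 𝒢C else perfectMatchings (blkC lab c)
  have h𝒢 : ∀ c, 𝒢 c ⊆ perfectMatchings (blkC lab c) := by
    intro c
    by_cases hc : c = Lbl.C
    · subst hc; simp only [𝒢, if_true]; exact h𝒢C
    · simp only [𝒢, if_neg hc]; exact Subset.rfl
  have hset : ((Mall lab).filter fun M => (M.filter fun e => e ∈ (blkC lab Lbl.C).sym2) ∈ 𝒢C) =
      (perfectMatchings ((univ : Finset (Lbl m)).biUnion (blkC lab))).filter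
        fun M => (∀ e ∈ M, ∃ c, e ∈ (blkC lab c).sym2) ∧
          ∀ c, (M.filter fun e => e ∈ (blkC lab c).sym2) ∈ 𝒢 c := by
    ext M
    rw [mem_filter, mem_filter, mem_Mall_iff_blocks]
    constructor
    · rintro ⟨⟨hPM, hresp⟩, hC⟩
      refine ⟨hPM, hresp, fun c => ?_⟩
      by_cases hc : c = Lbl.C
      · subst hc; simp only [𝒢, if_true]; exact hC
      · simp only [𝒢, if_neg hc]
        exact mem_perfectMatchings.2 ((mem_perfectMatchings.1 hPM).filter_block (blkC lab)
          (blkC_disjoint lab) univ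
          (fun e he => by obtain ⟨c, hc⟩ := hresp e he; exact ⟨c, mem_univ _, hc⟩) (mem_univ c))
    · rintro ⟨hPM, hresp, hall⟩
      have := hall Lbl.C
      simp only [𝒢, if_true] at this
      exact ⟨⟨hPM, hresp⟩, this⟩
  have key := card_blockPM_restrict (blkC lab) (blkC_disjoint lab) 𝒢 h𝒢
  have hprod : ∏ c, (𝒢 c).card = 𝒢C.card * wT lab := by
    rw [wT, ← Finset.prod_erase_mul _ _ (mem_univ Lbl.C)]
    simp only [𝒢, if_true, mul_comm]
    congr 1
    exact prod_congr rfl fun c hc => by rw [if_neg (ne_of_mem_erase hc)]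
  rw [hset, ← hprod]
  convert key using 2
  ext M
  simp only [mem_filter]

/-- For a perfect matching `F'` of `C ∪ D`: `M ∈ M_all(T)` contains `F'` iff its restriction to
`C ∪ D` is `F'`. [folklore] -/
theorem subset_iff_filter_eq {F' M : Finset (Sym2 (Fin n))} (hF' : IsPMOn (blkC lab Lbl.C) F')
    (hM : M ∈ Mall lab) : F' ⊆ M ↔ (M.filter fun e => e ∈ (blkC lab Lbl.C).sym2) = F' := by
  obtain ⟨hPM, hresp⟩ := mem_Mall_iff_blocks.1 hM
  have hblock : IsPMOn (blkC lab Lbl.C) (M.filter fun e => e ∈ (blkC lab Lbl.C).sym2) :=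
    (mem_perfectMatchings.1 hPM).filter_block (blkC lab) (blkC_disjoint lab) univ
      (fun e he => by obtain ⟨c, hc⟩ := hresp e he; exact ⟨c, mem_univ _, hc⟩) (mem_univ _)
  constructor
  · intro hsub
    refine (hF'.eq_of_subset hblock fun e he => mem_filter.2 ⟨hsub he, hF'.subset_sym2 he⟩).symm
  · intro heq
    rw [← heq]
    exact filter_subset _ _

/-- **`|{M ∈ M_all(T) : F' ⊆ M}| = w_T`** for every perfect matching `F'` of `C ∪ D` (the
normalisation of `p_{M,T}(F')` does not depend on `F'`). [cite: Rothvoss2017, §3.2 (PDF p. 9)] -/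
theorem card_supM {F' : Finset (Sym2 (Fin n))} (hF' : F' ∈ perfectMatchings (blkC lab Lbl.C)) :
    (supM lab F').card = wT lab := by
  have hset : supM lab F' = (Mall lab).filter fun M => (M.filter fun e => e ∈ (blkC lab Lbl.C).sym2) ∈ ({F'} : Finset _) := by
    ext M
    simp only [supM, mem_filter, mem_singleton]
    constructor
    · rintro ⟨hM, hsub⟩; exact ⟨hM, (subset_iff_filter_eq (mem_perfectMatchings.1 hF') hM).1 hsub⟩
    · rintro ⟨hM, heq⟩; exact ⟨hM, (subset_iff_filter_eq (mem_perfectMatchings.1 hF') hM).2 heq⟩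
  rw [hset, card_Mall_restrictC lab {F'} (singleton_subset_iff.2 hF'), card_singleton, one_mul]

/-! #### Lemma 8 in count form -/

/-- `pmCDH ⊆ pmCDsup`. [folklore] -/
theorem pmCDH_subset_pmCDsup (H : Finset (Sym2 (Fin n))) : pmCDH lab H ⊆ pmCDsup lab H := by
  intro F hF
  obtain ⟨hpm, hfil⟩ := mem_pmCDH_iff.1 hF
  refine mem_filter.2 ⟨mem_perfectMatchings.2 hpm, ?_⟩
  rw [← hfil]; exact filter_subset _ _

/-- **`|Y ∩ M^ex(T,H)| = Σ_{F' ∈ pmCDH T H} N(F')`** (decompose `M^ex(T,H)` by the restriction to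
`C ∪ D`) — the counting content of "`p^ex_{M,T}(H) = E_F[p_{M,T}(F)]`".
[cite: Rothvoss2017, Lemma 8 (proof, PDF p. 9)] -/
theorem card_inter_Mext_eq_sum (Y : Finset (Finset (Sym2 (Fin n)))) (lab : Fin n → Lbl m) (H : Finset (Sym2 (Fin n))) :
    (Y ∩ Mext lab H).card = ∑ F' ∈ pmCDH lab H, Ncnt Y lab F' := by
  classical
  rw [card_eq_sum_card_fiberwise (f := fun M => M.filter fun e => e ∈ (blkC lab Lbl.C).sym2)
    (t := pmCDH lab H) (s := Y ∩ Mext lab H) (fun M hM => ?_)]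
  · refine sum_congr rfl fun F' hF' => ?_
    rw [Ncnt]
    congr 1
    ext M
    simp only [mem_filter, mem_inter, supM]
    constructor
    · rintro ⟨⟨hY, hMext⟩, heq⟩
      have hM : M ∈ Mall lab := (mem_Mext_iff.1 hMext).1
      exact ⟨hY, hM, (subset_iff_filter_eq (mem_pmCDH_iff.1 hF').1 hM).2 heq⟩
    · rintro ⟨hY, hM, hsub⟩
      have heq := (subset_iff_filter_eq (mem_pmCDH_iff.1 hF').1 hM).1 hsub
      refine ⟨⟨hY, mem_Mext_iff.2 ⟨hM, ?_⟩⟩, heq⟩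
      rw [← filter_isCD_filter_blkC, heq]
      exact (mem_pmCDH_iff.1 hF').2
  · rw [Finset.mem_coe, mem_inter] at hM
    obtain ⟨-, hMext⟩ := hM
    have h := (mem_Mext_iff_blocks.1 hMext).2.2 Lbl.C
    simpa using h

/-- **Lemma 8, count form**: for an `M`-good pair, `|Y ∩ M^ex(T,H)| ≤ (1+ε) |pmCDH T H| · N̄`.
[cite: Rothvoss2017, Lemma 8 (PDF p. 9)] -/
theorem card_inter_Mext_le_navg {Y : Finset (Finset (Sym2 (Fin n)))} {H : Finset (Sym2 (Fin n))} {ε : ℝ}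
    (hgood : MGoodΩ Y lab H ε) :
    ((Y ∩ Mext lab H).card : ℝ) ≤ (1 + ε) * (pmCDH lab H).card * Navg Y lab H := by
  rw [card_inter_Mext_eq_sum]
  push_cast
  calc ∑ F' ∈ pmCDH lab H, (Ncnt Y lab F' : ℝ)
      ≤ ∑ F' ∈ pmCDH lab H, (1 + ε) * Navg Y lab H :=
        sum_le_sum fun F' hF' => (hgood.2 F' (pmCDH_subset_pmCDsup H hF')).2
    _ = (1 + ε) * (pmCDH lab H).card * Navg Y lab H := by
        rw [sum_const, nsmul_eq_mul]; ring

/-- A `k`-matching is a perfect matching of `C ∪ D` containing each of its `3`-subsets. [folklore] -/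
theorem mem_pmCDsup_of_mem_kext (hlab : lab ∈ partitions n m k) {H F : Finset (Sym2 (Fin n))}
    (hF : F ∈ kext lab k H) : F ∈ pmCDsup lab H := by
  obtain ⟨hFk, hHF⟩ := mem_filter.1 hF
  exact mem_filter.2 ⟨mem_perfectMatchings.2 (isPMOn_of_mem_cdMatchings_k hlab hFk), hHF⟩

/-- For a `k`-matching `F`, `M^ex(T, F) = {M ∈ M_all(T) : F ⊆ M}`. [folklore] -/
theorem Mext_eq_supM_k (hlab : lab ∈ partitions n m k) {F : Finset (Sym2 (Fin n))}
    (hF : F ∈ cdMatchings lab k) : Mext lab F = supM lab F := by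
  have hFpm := isPMOn_of_mem_cdMatchings_k hlab hF
  ext M
  rw [mem_Mext_iff, supM, mem_filter]
  constructor
  · rintro ⟨hM, hfil⟩; exact ⟨hM, by rw [← hfil]; exact filter_subset _ _⟩
  · rintro ⟨hM, hsub⟩
    refine ⟨hM, ?_⟩
    have heq := (subset_iff_filter_eq hFpm hM).1 hsub
    rw [← filter_isCD_filter_blkC, heq]
    refine filter_true_of_mem (mem_cdMatchings_iff.1 hF).1

/-- **The `M`-side comparison**: for an `M`-good `(T, H)` and a `k`-matching `F ⊇ H`,
`|Y ∩ M^ex(T,H)| ≤ (1+ε)² P(k-3)² |Y ∩ M^ex(T,F)|` ("`p^ex_M(H) ≤ (1+ε) p_M(H) ≤ (1+ε)² p^ex_M(F)`").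
[cite: Rothvoss2017, §3.4 (PDF p. 10)] -/
theorem card_inter_Mext_three_le (hlab : lab ∈ partitions n m k) {Y : Finset (Finset (Sym2 (Fin n)))}
    {H F : Finset (Sym2 (Fin n))} {ε : ℝ} (hε : 0 ≤ ε) (hH : H ∈ cdMatchings lab 3)
    (hF : F ∈ kext lab k H) (hgood : MGoodΩ Y lab H ε) :
    ((Y ∩ Mext lab H).card : ℝ) ≤
      (1 + ε) ^ 2 * (pmCount (k - 3) * pmCount (k - 3) : ℕ) * (Y ∩ Mext lab F).card := by
  have h8 := card_inter_Mext_le_navg hgood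
  have hFsup := mem_pmCDsup_of_mem_kext hlab hF
  have hNF : Navg Y lab H / (1 + ε) ≤ Ncnt Y lab F := (hgood.2 F hFsup).1
  have hε1 : 0 < 1 + ε := by linarith
  have hNavg : Navg Y lab H ≤ (1 + ε) * Ncnt Y lab F := by
    rw [div_le_iff₀ hε1] at hNF; linarith
  have hMextF : (Y ∩ Mext lab F).card = Ncnt Y lab F := by
    rw [Ncnt, Mext_eq_supM_k hlab (mem_filter.1 hF).1]
  rw [hMextF, ← card_pmCDH hlab hH]
  have hc : (0 : ℝ) ≤ (pmCDH lab H).card := Nat.cast_nonneg _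
  calc ((Y ∩ Mext lab H).card : ℝ) ≤ (1 + ε) * (pmCDH lab H).card * Navg Y lab H := h8
    _ ≤ (1 + ε) * (pmCDH lab H).card * ((1 + ε) * Ncnt Y lab F) :=
        mul_le_mul_of_nonneg_left hNavg (by positivity)
    _ = (1 + ε) ^ 2 * (pmCDH lab H).card * (Ncnt Y lab F) := by ring
    _ = (1 + ε) ^ 2 * ((pmCDH lab H).card : ℕ) * (Ncnt Y lab F) := by norm_cast

/-- For a `k`-matching `F`, `U^ex(T, F) = U^ex_all(T, C)`. [folklore] -/
theorem Uext_k_eq_UextC (hlab : lab ∈ partitions n m k) {F : Finset (Sym2 (Fin n))}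
    (hF : F ∈ cdMatchings lab k) : Uext lab t F = UextC lab t := by
  have hcov : cov lab F = lblk lab Lbl.C := by
    refine eq_of_subset_of_card_le (fun c hc => mem_lblk.2 (mem_cov_iff.1 hc).1) ?_
    rw [card_cov hF, (mem_partitions_iff.1 hlab) Lbl.C]
    exact le_of_eq rfl
  ext U
  rw [mem_Uext_iff, UextC, mem_filter, hcov]
  constructor
  · rintro ⟨hU, heq⟩; exact ⟨hU, by rw [← heq]; exact inter_subset_left⟩
  · rintro ⟨hU, hsub⟩; exact ⟨hU, inter_eq_right.2 hsub⟩

/-- **The pointwise comparison for a good pair**: if `(T, H)` is good and `F ⊇ H` is a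
`k`-matching between `C` and `D`, then `term_3(T,H) ≤ (1+ε)³ P(k-3)² · term_k(T,F)`.
[cite: Rothvoss2017, §3.4 (PDF p. 10: "p^ex_M(H) ≤ (1+ε)² p^ex_M(F)", "p^ex_U(H) ≤ (1+ε) p^ex_U(F)")] -/
theorem termN_three_le (hlab : lab ∈ partitions n m k) {X : Finset (Finset (Fin n))}
    {Y : Finset (Finset (Sym2 (Fin n)))} {H F : Finset (Sym2 (Fin n))} {ε : ℝ} (hε : 0 ≤ ε)
    (hH : H ∈ cdMatchings lab 3) (hF : F ∈ kext lab k H) (hgood : GoodΩ X Y lab t H ε) :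
    (termN t X Y lab H : ℝ) ≤
      (1 + ε) ^ 3 * (pmCount (k - 3) * pmCount (k - 3) : ℕ) * termN t X Y lab F := by
  obtain ⟨hM, hU⟩ := hgood
  have hFk : F ∈ cdMatchings lab k := (mem_filter.1 hF).1
  have h1 := card_inter_Mext_three_le hlab hε hH hF hM
  have h2 : ((X ∩ Uext lab t H).card : ℝ) ≤ (1 + ε) * (X ∩ Uext lab t F).card := by
    rw [Uext_k_eq_UextC hlab hFk]; exact hU.2.1
  rw [termN, termN]
  push_cast
  have hA : (0 : ℝ) ≤ (X ∩ Uext lab t H).card := Nat.cast_nonneg _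
  have hB : (0 : ℝ) ≤ (Y ∩ Mext lab F).card := Nat.cast_nonneg _
  have hc : (0 : ℝ) ≤ (pmCount (k - 3) * pmCount (k - 3) : ℕ) := Nat.cast_nonneg _
  calc ((X ∩ Uext lab t H).card : ℝ) * (Y ∩ Mext lab H).card
      ≤ ((1 + ε) * (X ∩ Uext lab t F).card) *
          ((1 + ε) ^ 2 * (pmCount (k - 3) * pmCount (k - 3) : ℕ) * (Y ∩ Mext lab F).card) :=
        mul_le_mul h2 h1 (Nat.cast_nonneg _) (by positivity)
    _ = (1 + ε) ^ 3 * ((pmCount (k - 3) : ℝ) * pmCount (k - 3)) *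
          (((X ∩ Uext lab t F).card : ℝ) * (Y ∩ Mext lab F).card) := by push_cast; ring

end Goodness

/-! ### Lemma 9: few good `3`-subsets of a `k`-matching -/

section Lemma9

/-- **Extremal lemma**: a family of `3`-subsets of `F` any two of which share at least two
elements has at most `3(|F| - 3) + 1` members (fix `H₀`; every other member is
`H₀ - a + b`). [cite: Rothvoss2017, proof of Lemma 9 (PDF p. 10: "≤ 3k / C(k,3)")] -/
theorem card_le_of_pairwise_two_le_inter {α : Type*} [DecidableEq α] (F : Finset α)
    (𝒢 : Finset (Finset α)) (h𝒢 : ∀ H ∈ 𝒢, H ⊆ F ∧ H.card = 3)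
    (hpair : ∀ H ∈ 𝒢, ∀ H' ∈ 𝒢, 2 ≤ (H ∩ H').card) : 𝒢.card ≤ 3 * (F.card - 3) + 1 := by
  rcases 𝒢.eq_empty_or_nonempty with rfl | ⟨H₀, hH₀⟩
  · simp
  obtain ⟨hH₀F, hH₀c⟩ := h𝒢 H₀ hH₀
  -- every other member differs from `H₀` in exactly one element
  have hone : ∀ H ∈ 𝒢.erase H₀, (H₀ \ H).card = 1 ∧ (H \ H₀).card = 1 := by
    intro H hH
    obtain ⟨hne, hH⟩ := mem_erase.1 hH
    obtain ⟨hHF, hHc⟩ := h𝒢 H hH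
    have h2 := hpair H hH H₀ hH₀
    have hle : (H ∩ H₀).card ≤ 3 := hHc ▸ card_le_card inter_subset_left
    have hne3 : (H ∩ H₀).card ≠ 3 := by
      intro h3
      have heq1 : H ∩ H₀ = H := eq_of_subset_of_card_le inter_subset_left (by rw [h3, hHc])
      have heq2 : H ∩ H₀ = H₀ := eq_of_subset_of_card_le inter_subset_right (by rw [h3, hH₀c])
      exact hne (heq1.symm.trans heq2)
    have hint : (H ∩ H₀).card = 2 := by omega
    have h1 := card_sdiff_add_card_inter H₀ H
    have h1' := card_sdiff_add_card_inter H H₀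
    rw [inter_comm] at h1
    constructor <;> omega
  have hinj : Set.InjOn (fun H => (H₀ \ H, H \ H₀)) ↑(𝒢.erase H₀) := by
    intro H₁ h₁ H₂ h₂ heq
    simp only [Prod.mk.injEq] at heq
    obtain ⟨ha, hb⟩ := heq
    have key : ∀ H : Finset α, H = (H₀ \ (H₀ \ H)) ∪ (H \ H₀) := by
      intro H
      rw [sdiff_sdiff_self_left, inter_comm, union_comm, Finset.sdiff_union_inter]
    rw [key H₁, key H₂, ha, hb]
  have hmaps : Set.MapsTo (fun H => (H₀ \ H, H \ H₀)) ↑(𝒢.erase H₀)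
      ↑(H₀.powersetCard 1 ×ˢ (F \ H₀).powersetCard 1) := by
    intro H hH
    rw [Finset.mem_coe] at hH
    obtain ⟨h1, h2⟩ := hone H hH
    rw [Finset.mem_coe, mem_product, mem_powersetCard, mem_powersetCard]
    exact ⟨⟨sdiff_subset, h1⟩, ⟨sdiff_subset_sdiff (h𝒢 H (mem_erase.1 hH).2).1 Subset.rfl, h2⟩⟩
  have hbound := card_le_card_of_injOn _ hmaps hinj
  rw [card_product, card_powersetCard, card_powersetCard, Nat.choose_one_right, Nat.choose_one_right,
    hH₀c, card_sdiff_of_subset hH₀F, hH₀c] at hbound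
  have := card_erase_add_one hH₀
  omega

variable {lab : Fin n → Lbl m} {t : ℕ} {X : Finset (Finset (Fin n))} {Y : Finset (Finset (Sym2 (Fin n)))}
  {ε : ℝ}

/-- The crossing edges of a pair `(U, M)` extending `(T, H)`, when `M` contains the edge between
two of the three `C`-vertices `u, v` of `H`: exactly the `M`-edge at the third one `w`.
[cite: Rothvoss2017, proof of Lemma 9 (PDF p. 10: "(u,v) runs inside of U and hence |δ(U) ∩ M| = 1")] -/
theorem filter_crosses_eq_filter_mem {H : Finset (Sym2 (Fin n))} {U : Finset (Fin n)} {M : Finset (Sym2 (Fin n))}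
    {u v w : Fin n} (hU : U ∈ Uext lab t H) (hM : M ∈ Mall lab) (huv : s(u, v) ∈ M)
    (hcov : ∀ a, a ∈ cov lab H ↔ a = u ∨ a = v ∨ a = w) (hwu : w ≠ u) (hwv : w ≠ v) :
    M.filter (Crosses U) = M.filter fun e => w ∈ e := by
  obtain ⟨hUall, hUC⟩ := mem_Uext_iff.1 hU
  obtain ⟨hPM, hresp⟩ := mem_Mall_iff.1 hM
  have hcovU : ∀ a, a ∈ cov lab H → a ∈ U := fun a ha => by
    rw [← hUC] at ha; exact (mem_inter.1 ha).1
  have huU : u ∈ U := hcovU u ((hcov u).2 (Or.inl rfl))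
  have hvU : v ∈ U := hcovU v ((hcov v).2 (Or.inr (Or.inl rfl)))
  have hwU : w ∈ U := hcovU w ((hcov w).2 (Or.inr (Or.inr rfl)))
  -- the `M`-edge at `u` and at `v` is `{u, v}`
  have hedge_u : ∀ e ∈ M, u ∈ e → e = s(u, v) := fun e he hue =>
    hPM.unique he huv hue (Sym2.mem_mk_left u v)
  have hedge_v : ∀ e ∈ M, v ∈ e → e = s(u, v) := fun e he hve =>
    hPM.unique he huv hve (Sym2.mem_mk_right u v)
  ext e
  simp only [mem_filter]
  constructor
  · rintro ⟨he, hcross⟩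
    refine ⟨he, ?_⟩
    induction e using Sym2.ind with
    | h a b =>
      rw [crosses_mk] at hcross
      wlog hab : a ∈ U ∧ b ∉ U generalizing a b
      · have h' : b ∈ U ∧ a ∉ U := by tauto
        have := this b a (by rwa [Sym2.eq_swap]) (Or.inl h') h'
        rw [Sym2.eq_swap]; exact this
      obtain ⟨haU, hbU⟩ := hab
      obtain ⟨hla, -⟩ := label_of_crossing hUall (hresp _ he) haU hbU
      have hacov : a ∈ cov lab H := by rw [← hUC]; exact mem_inter.2 ⟨haU, mem_lblk.2 hla⟩
      rcases (hcov a).1 hacov with rfl | rfl | rfl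
      · have := hedge_u _ he (Sym2.mem_mk_left _ _)
        have hb : b ∈ s(a, v) := this ▸ Sym2.mem_mk_right a b
        rcases Sym2.mem_iff.1 hb with rfl | rfl
        · exact absurd haU hbU
        · exact absurd hvU hbU
      · have := hedge_v _ he (Sym2.mem_mk_left _ _)
        have hb : b ∈ s(u, a) := this ▸ Sym2.mem_mk_right a b
        rcases Sym2.mem_iff.1 hb with rfl | rfl
        · exact absurd huU hbU
        · exact absurd haU hbU
      · exact Sym2.mem_mk_left _ _
  · rintro ⟨he, hwe⟩
    refine ⟨he, ?_⟩
    have he' : e = s(w, Sym2.Mem.other hwe) := (Sym2.other_spec hwe).symm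
    set b := Sym2.Mem.other hwe with hb
    rw [he', crosses_mk]
    refine Or.inl ⟨hwU, fun hbU => ?_⟩
    -- `b ∈ U` is impossible
    have hresp_e := hresp e he
    rw [he', eResp_mk] at hresp_e
    have hbAC := (mem_Uall_iff.1 hUall).2.1 b hbU
    have hwC : lab w = Lbl.C := (mem_cov_iff.1 ((hcov w).2 (Or.inr (Or.inr rfl)))).1
    rw [hwC, cls_C] at hresp_e
    have hlb : lab b = Lbl.C := by
      rcases cls_eq_C_iff.1 hresp_e.symm with h | h
      · exact h
      · rw [h] at hbAC; exact absurd hbAC (by simp [Lbl.isAC])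
    have hbcov : b ∈ cov lab H := by rw [← hUC]; exact mem_inter.2 ⟨hbU, mem_lblk.2 hlb⟩
    rcases (hcov b).1 hbcov with hb' | hb' | hb'
    · have := hedge_u e he (by rw [he', hb']; exact Sym2.mem_mk_right _ _)
      have hw' : w ∈ s(u, v) := this ▸ hwe
      rcases Sym2.mem_iff.1 hw' with h | h
      · exact hwu h
      · exact hwv h
    · have := hedge_v e he (by rw [he', hb']; exact Sym2.mem_mk_right _ _)
      have hw' : w ∈ s(u, v) := this ▸ hwe
      rcases Sym2.mem_iff.1 hw' with h | h
      · exact hwu h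
      · exact hwv h
    · exact hPM.not_isDiag he (by rw [he', hb']; exact Sym2.mk_isDiag_iff.2 rfl)

/-- **Two good `3`-subsets of a `k`-matching share at least two edges** when the rectangle
`X × Y` has no entry with exactly one crossing edge.
[cite: Rothvoss2017, proof of Lemma 9 (PDF p. 10)] -/
theorem two_le_card_inter_of_goodΩ (hlab : lab ∈ partitions n m k) (hk : 4 ≤ k) (hε : 0 ≤ ε)
    (havoid : ∀ U ∈ X, ∀ M ∈ Y, (M.filter (Crosses U)).card ≠ 1)
    {F : Finset (Sym2 (Fin n))} (hF : F ∈ cdMatchings lab k)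
    {H H' : Finset (Sym2 (Fin n))} (hH : H ∈ cdMatchings lab 3) (hH' : H' ∈ cdMatchings lab 3)
    (hHF : H ⊆ F) (hH'F : H' ⊆ F) (hgood : GoodΩ X Y lab t H ε) (hgood' : GoodΩ X Y lab t H' ε) :
    2 ≤ (H ∩ H').card := by
  classical
  by_contra hlt
  push Not at hlt
  obtain ⟨hFcd, hFcard, hFdisj⟩ := mem_cdMatchings_iff.1 hF
  obtain ⟨hHcd, hHcard, hHdisj⟩ := mem_cdMatchings_iff.1 hH
  -- two edges of `H ∖ H'`, with distinct `C`-ends `u, v ∉ V(H')`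
  have hsd : 1 < (H \ H').card := by
    have := card_sdiff_add_card_inter H H'
    omega
  obtain ⟨h₁, hh₁, h₂, hh₂, hne⟩ := one_lt_card.1 hsd
  rw [mem_sdiff] at hh₁ hh₂
  obtain ⟨u, d₁, rfl, hu, hd₁⟩ := hHcd _ hh₁.1
  obtain ⟨v, d₂, rfl, hv, hd₂⟩ := hHcd _ hh₂.1
  have huv : u ≠ v := by
    intro h; subst h
    exact hne (hHdisj _ hh₁.1 _ hh₂.1 u (Sym2.mem_mk_left _ _) (Sym2.mem_mk_left _ _))
  have hnotverts : ∀ {c d : Fin n}, s(c, d) ∈ H → s(c, d) ∉ H' → c ∉ verts H' := by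
    intro c d hcd hcd' hc
    obtain ⟨e, he, hce⟩ := mem_verts.1 hc
    have : s(c, d) = e := hFdisj _ (hHF hcd) _ (hH'F he) c (Sym2.mem_mk_left _ _) hce
    exact hcd' (this ▸ he)
  have huH' : u ∉ verts H' := hnotverts hh₁.1 hh₁.2
  have hvH' : v ∉ verts H' := hnotverts hh₂.1 hh₂.2
  -- `F* := H' ∪ {uv} ∪` (a perfect matching of the rest) is a perfect matching of `C ∪ D`
  set S₀ := blkC lab Lbl.C with hS₀
  have hH'pm : IsPMOn (verts H') H' := isPMOn_verts hH'
  have hvertsS : verts H' ⊆ S₀ := verts_subset_blkC hH'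
  have huS : u ∈ S₀ := by rw [hS₀, mem_blkC, hu]; rfl
  have hvS : v ∈ S₀ := by rw [hS₀, mem_blkC, hv]; rfl
  set R := S₀ \ (verts H' ∪ {u, v}) with hR
  have hcardS : S₀.card = 2 * k := by
    rw [hS₀, blkC_C, card_union_of_disjoint, (mem_partitions_iff.1 hlab) Lbl.C, (mem_partitions_iff.1 hlab) Lbl.D]
    · show k + k = 2 * k; ring
    · rw [disjoint_left]; intro x hx hx'; rw [mem_lblk] at hx hx'; rw [hx] at hx'; cases hx'
  have hcardV : (verts H' ∪ {u, v}).card = 8 := by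
    rw [card_union_of_disjoint, card_pair huv]
    · have := hH'pm.two_mul_card
      rw [(mem_cdMatchings_iff.1 hH').2.1] at this
      omega
    · rw [disjoint_left]
      intro x hx hx'
      simp only [mem_insert, mem_singleton] at hx'
      rcases hx' with rfl | rfl
      · exact huH' hx
      · exact hvH' hx
  have hVsub : verts H' ∪ {u, v} ⊆ S₀ := by
    refine union_subset hvertsS ?_
    intro x hx
    simp only [mem_insert, mem_singleton] at hx
    rcases hx with rfl | rfl
    · exact huS
    · exact hvS
  have hReven : Even R.card := by
    rw [hR, card_sdiff_of_subset hVsub, hcardS, hcardV]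
    exact ⟨k - 4, by omega⟩
  obtain ⟨G, hG⟩ := exists_isPMOn_of_even R.card R rfl hReven
  have hpair : IsPMOn ({u, v} : Finset (Fin n)) {s(u, v)} := IsPMOn.pair huv
  have hd1 : Disjoint (verts H') {u, v} := by
    rw [disjoint_left]
    intro x hx hx'
    simp only [mem_insert, mem_singleton] at hx'
    rcases hx' with rfl | rfl
    · exact huH' hx
    · exact hvH' hx
  have hd2 : Disjoint (verts H' ∪ {u, v}) R := by rw [hR]; exact disjoint_sdiff
  have hFstar : IsPMOn S₀ (H' ∪ {s(u, v)} ∪ G) := by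
    have h12 := hH'pm.union hpair hd1
    have h123 := h12.union hG hd2
    rwa [hR, union_sdiff_of_subset hVsub] at h123
  have hFsup : H' ∪ {s(u, v)} ∪ G ∈ pmCDsup lab H' :=
    mem_filter.2 ⟨mem_perfectMatchings.2 hFstar,
      subset_union_left.trans subset_union_left⟩
  -- `M`-goodness of `H'`: some `M ∈ Y ∩ M_all(T)` contains `F*`, hence the edge `uv`
  obtain ⟨⟨hMgood', -⟩, -⟩ := And.intro hgood' trivial
  have hNpos : 0 < Ncnt Y lab (H' ∪ {s(u, v)} ∪ G) := by
    have h1 := (hMgood'.2 _ hFsup).1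
    have h2 : 0 < Navg Y lab H' / (1 + ε) := div_pos hMgood'.1 (by linarith)
    have : (0 : ℝ) < Ncnt Y lab (H' ∪ {s(u, v)} ∪ G) := lt_of_lt_of_le h2 h1
    exact_mod_cast this
  obtain ⟨M, hM⟩ := card_pos.1 hNpos
  rw [mem_inter] at hM
  obtain ⟨hMY, hMsup⟩ := hM
  obtain ⟨hMall, hFM⟩ := mem_filter.1 hMsup
  have huvM : s(u, v) ∈ M := hFM (mem_union_left _ (mem_union_right _ (mem_singleton_self _)))
  -- `U`-goodness of `H`: some `U ∈ X ∩ U^ex(T, H)`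
  obtain ⟨U, hU⟩ := card_pos.1 hgood.2.1
  rw [mem_inter] at hU
  obtain ⟨hUX, hUext⟩ := hU
  -- the third `C`-vertex `w` of `H`
  have hucov : u ∈ cov lab H := mem_cov_iff.2 ⟨hu, _, hh₁.1, Sym2.mem_mk_left _ _⟩
  have hvcov : v ∈ cov lab H := mem_cov_iff.2 ⟨hv, _, hh₂.1, Sym2.mem_mk_left _ _⟩
  have hcard3 : (cov lab H).card = 3 := card_cov hH
  have hrest1 : ((cov lab H).erase u |>.erase v).card = 1 := by
    rw [card_erase_of_mem (mem_erase.2 ⟨huv.symm, hvcov⟩), card_erase_of_mem hucov, hcard3]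
  obtain ⟨w, hw⟩ := card_eq_one.1 hrest1
  have hwmem : w ∈ ((cov lab H).erase u).erase v := by rw [hw]; exact mem_singleton_self w
  have hwv : w ≠ v := (mem_erase.1 hwmem).1
  have hwu : w ≠ u := (mem_erase.1 (mem_erase.1 hwmem).2).1
  have hcov : ∀ a, a ∈ cov lab H ↔ a = u ∨ a = v ∨ a = w := by
    intro a
    constructor
    · intro ha
      by_cases hau : a = u
      · exact Or.inl hau
      by_cases hav : a = v
      · exact Or.inr (Or.inl hav)
      have : a ∈ ((cov lab H).erase u).erase v := mem_erase.2 ⟨hav, mem_erase.2 ⟨hau, ha⟩⟩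
      rw [hw, mem_singleton] at this
      exact Or.inr (Or.inr this)
    · rintro (rfl | rfl | rfl)
      · exact hucov
      · exact hvcov
      · exact (mem_erase.1 (mem_erase.1 hwmem).2).2
  -- exactly one crossing edge: contradiction
  have hone : (M.filter (Crosses U)).card = 1 := by
    rw [filter_crosses_eq_filter_mem hUext hMall huvM hcov hwu hwv]
    exact (mem_Mall_iff.1 hMall).1.card_filter (mem_univ w)
  exact havoid U hUX M hMY hone

/-- **Lemma 9**: among the `3`-subsets of a `k`-matching `F`, at most `3(k-3) + 1` are good
(when the rectangle avoids `Q_1`). [cite: Rothvoss2017, Lemma 9 (PDF p. 10)] -/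
theorem card_good_subsets_le (hlab : lab ∈ partitions n m k) (hk : 4 ≤ k) (hε : 0 ≤ ε)
    (havoid : ∀ U ∈ X, ∀ M ∈ Y, (M.filter (Crosses U)).card ≠ 1)
    {F : Finset (Sym2 (Fin n))} (hF : F ∈ cdMatchings lab k) :
    (((cdMatchings lab 3).filter fun H => H ⊆ F).filter fun H => GoodΩ X Y lab t H ε).card ≤ 3 * (k - 3) + 1 := by
  have hFcard : F.card = k := (mem_cdMatchings_iff.1 hF).2.1
  rw [← hFcard]
  refine card_le_of_pairwise_two_le_inter F _ (fun H hH => ?_) (fun H hH H' hH' => ?_)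
  · rw [mem_filter, mem_filter] at hH
    exact ⟨hH.1.2, (mem_cdMatchings_iff.1 hH.1.1).2.1⟩
  · rw [mem_filter, mem_filter] at hH hH'
    exact two_le_card_inter_of_goodΩ hlab hk hε havoid hF hH.1.1 hH'.1.1 hH.1.2 hH'.1.2 hH.2 hH'.2

end Lemma9

/-! ### The contribution of good pairs: per partition and summed -/

section GoodSum

variable {lab : Fin n → Lbl m} {t : ℕ} {X : Finset (Finset (Fin n))} {Y : Finset (Finset (Sym2 (Fin n)))}
  {ε : ℝ}

/-- Exchanging the sums over `H` and over the `k`-matchings `F ⊇ H`. [folklore] -/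
theorem sum_sum_kext_comm (A : Finset (Finset (Sym2 (Fin n)))) (g : Finset (Sym2 (Fin n)) → ℝ) :
    ∑ H ∈ A, ∑ _F ∈ kext lab k H, g _F = ∑ F ∈ cdMatchings lab k, ∑ _H ∈ A.filter (fun H => H ⊆ F), g F := by
  classical
  simp only [kext, sum_filter]
  rw [sum_comm]

/-- **The good part, per partition**: `c₁ · Σ_{H good} term_3(T,H) ≤ (1+ε)³ P(k-3)² (3(k-3)+1) · Σ_F term_k(T,F)`,
where `c₁ = |kext|` (constant). [cite: Rothvoss2017, §3.4 (PDF p. 10: the displayed computation)] -/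
theorem good_sum_le (hlab : lab ∈ partitions n m k) (hk : 4 ≤ k) (hε : 0 ≤ ε)
    (havoid : ∀ U ∈ X, ∀ M ∈ Y, (M.filter (Crosses U)).card ≠ 1) {c₁ : ℕ}
    (hc₁ : ∀ H ∈ cdMatchings lab 3, (kext lab k H).card = c₁) :
    (c₁ : ℝ) * ∑ H ∈ (cdMatchings lab 3).filter (fun H => GoodΩ X Y lab t H ε), (termN t X Y lab H : ℝ) ≤
      (1 + ε) ^ 3 * (pmCount (k - 3) * pmCount (k - 3) : ℕ) * (3 * (k - 3) + 1 : ℕ) *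
        ∑ F ∈ cdMatchings lab k, (termN t X Y lab F : ℝ) := by
  classical
  set K : ℝ := (1 + ε) ^ 3 * (pmCount (k - 3) * pmCount (k - 3) : ℕ) with hK
  have hK0 : 0 ≤ K := by rw [hK]; positivity
  set A := (cdMatchings lab 3).filter (fun H => GoodΩ X Y lab t H ε) with hA
  -- insert the `c₁` copies of each term as a sum over `kext`
  have h1 : (c₁ : ℝ) * ∑ H ∈ A, (termN t X Y lab H : ℝ) = ∑ H ∈ A, ∑ F ∈ kext lab k H, (termN t X Y lab H : ℝ) := by
    rw [mul_sum]
    refine sum_congr rfl fun H hH => ?_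
    rw [sum_const, nsmul_eq_mul, hc₁ H (mem_filter.1 hH).1]
  -- pointwise comparison
  have h2 : ∑ H ∈ A, ∑ F ∈ kext lab k H, (termN t X Y lab H : ℝ) ≤
      ∑ H ∈ A, ∑ F ∈ kext lab k H, K * (termN t X Y lab F : ℝ) := by
    refine sum_le_sum fun H hH => sum_le_sum fun F hF => ?_
    obtain ⟨hH3, hgood⟩ := mem_filter.1 hH
    exact termN_three_le hlab hε hH3 hF hgood
  -- exchange and bound the number of good subsets
  have h3 : ∑ H ∈ A, ∑ F ∈ kext lab k H, K * (termN t X Y lab F : ℝ) =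
      ∑ F ∈ cdMatchings lab k, ((A.filter fun H => H ⊆ F).card : ℝ) * (K * termN t X Y lab F) := by
    rw [sum_sum_kext_comm]
    refine sum_congr rfl fun F _ => ?_
    rw [sum_const, nsmul_eq_mul]
  have h4 : ∀ F ∈ cdMatchings lab k, ((A.filter fun H => H ⊆ F).card : ℝ) ≤ (3 * (k - 3) + 1 : ℕ) := by
    intro F hF
    have := card_good_subsets_le (t := t) (X := X) (Y := Y) (ε := ε) hlab hk hε havoid hF
    have heq : (A.filter fun H => H ⊆ F) = ((cdMatchings lab 3).filter fun H => H ⊆ F).filter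
        fun H => GoodΩ X Y lab t H ε := by
      ext H; simp only [hA, mem_filter]; tauto
    rw [heq]
    exact_mod_cast this
  rw [h1]
  refine h2.trans ?_
  rw [h3, mul_sum]
  refine sum_le_sum fun F hF => ?_
  have hT : (0 : ℝ) ≤ termN t X Y lab F := Nat.cast_nonneg _
  calc ((A.filter fun H => H ⊆ F).card : ℝ) * (K * termN t X Y lab F)
      ≤ (3 * (k - 3) + 1 : ℕ) * (K * termN t X Y lab F) := mul_le_mul_of_nonneg_right (h4 F hF) (by positivity)
    _ = K * (3 * (k - 3) + 1 : ℕ) * termN t X Y lab F := by ring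

end GoodSum

/-! ### The global inequality for the good part -/

section Global

variable {t : ℕ} {X : Finset (Finset (Fin n))} {Y : Finset (Finset (Sym2 (Fin n)))} {ε : ℝ}

/-- `|Ω_r| = Σ_T |cdM_r(T)| · u · (|pmCDH| w_T)` when the extension sets have constant sizes.
[folklore] -/
theorem card_Omega_eq_sum_const {r : ℕ} {u c : ℕ}
    (hu : ∀ lab ∈ partitions n m k, ∀ H ∈ cdMatchings lab r, (Uext lab t H).card = u)
    (hc : ∀ lab ∈ partitions n m k, ∀ H ∈ cdMatchings lab r, (Mext lab H).card = c * wT lab) :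
    (Omega n m k t r).card = ∑ lab ∈ partitions n m k, (cdMatchings lab r).card * (u * (c * wT lab)) := by
  rw [card_Omega_eq_sum]
  refine sum_congr rfl fun lab hlab => ?_
  exact sum_const_nat fun H hH => by rw [hu lab hlab H hH, hc lab hlab H hH]

/-- **The contribution of the good pairs** (Rothvoß's `≤ (200/k²) μ_k(R)`, here in cross-multiplied
sample-space form): `|Ω_3^{good} ∩ R| · |Ω_k| ≤ (1+ε)³ · ((3(k-3)+1)/C(k,3)) · |Ω_k ∩ R| · |Ω_3|`
at Rothvoß's parameters (`m` odd, `t = (m+1)(k-3)/2 + 3`), for a rectangle `R = X × Y` avoiding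
`Q_1`. Hypotheses `hc₁`: the number `c₁` of `k`-matchings containing a `3`-matching is a positive
constant (`card_kext_eq`, `sum_card_kext`). [cite: Rothvoss2017, §3.4 (PDF p. 10)] -/
theorem card_OmegaR_good_mul_le (hk : 4 ≤ k) (hm : m % 2 = 1) (hε : 0 ≤ ε)
    (ht : t = (m + 1) / 2 * (k - 3) + 3)
    (havoid : ∀ U ∈ X, ∀ M ∈ Y, (M.filter (Crosses U)).card ≠ 1) {c₁ : ℕ} (hc₁pos : 0 < c₁)
    (hc₁ : ∀ lab ∈ partitions n m k, ∀ H ∈ cdMatchings lab 3, (kext lab k H).card = c₁) :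
    (((OmegaR n m k t 3 X Y).filter fun ω => GoodΩ X Y ω.1 t (ω.2.2.filter (IsCD ω.1)) ε).card : ℝ) *
        (Omega n m k t k).card ≤
      (1 + ε) ^ 3 * ((3 * (k - 3) + 1 : ℕ) / (k.choose 3 : ℝ)) * (OmegaR n m k t k X Y).card *
        (Omega n m k t 3).card := by
  classical
  subst ht
  set c₃ : ℕ := pmCount (k - 3) * pmCount (k - 3) with hc₃
  set u : ℕ := m.choose ((m + 1) / 2) with hu
  set g : ℕ := 3 * (k - 3) + 1 with hg
  -- the four counts as sums over partitions
  have hG : (((OmegaR n m k ((m + 1) / 2 * (k - 3) + 3) 3 X Y).filter fun ω =>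
      GoodΩ X Y ω.1 ((m + 1) / 2 * (k - 3) + 3) (ω.2.2.filter (IsCD ω.1)) ε).card : ℝ) =
      ∑ lab ∈ partitions n m k, ∑ H ∈ (cdMatchings lab 3).filter (fun H => GoodΩ X Y lab ((m + 1) / 2 * (k - 3) + 3) H ε),
        (termN ((m + 1) / 2 * (k - 3) + 3) X Y lab H : ℝ) := by
    rw [card_OmegaR_filter_eq_sum ((m + 1) / 2 * (k - 3) + 3) 3 X Y (fun lab H => GoodΩ X Y lab ((m + 1) / 2 * (k - 3) + 3) H ε)]
    push_cast
    rfl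
  have hRk : ((OmegaR n m k ((m + 1) / 2 * (k - 3) + 3) k X Y).card : ℝ) =
      ∑ lab ∈ partitions n m k, ∑ F ∈ cdMatchings lab k, (termN ((m + 1) / 2 * (k - 3) + 3) X Y lab F : ℝ) := by
    rw [card_OmegaR_eq_sum]; push_cast; rfl
  have hΩ3 : (Omega n m k ((m + 1) / 2 * (k - 3) + 3) 3).card =
      ∑ lab ∈ partitions n m k, (cdMatchings lab 3).card * (u * (c₃ * wT lab)) :=
    card_Omega_eq_sum_const
      (fun lab hlab H hH => card_Uext hlab hH (by omega) (j := (m + 1) / 2) (by ring))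
      (fun lab hlab H hH => card_Mext_three hlab hH)
  have hΩk : (Omega n m k ((m + 1) / 2 * (k - 3) + 3) k).card =
      ∑ lab ∈ partitions n m k, (cdMatchings lab k).card * (u * (1 * wT lab)) := by
    refine card_Omega_eq_sum_const (fun lab hlab F hF => ?_) (fun lab hlab F hF => by rw [card_Mext_k hlab hF, one_mul])
    rw [card_Uext hlab hF (by omega) (j := (m - 1) / 2) ?_]
    · rw [hu]
      conv_rhs => rw [← Nat.choose_symm (show (m + 1) / 2 ≤ m by omega)]
      congr 1; omega
    · have hq : (m + 1) / 2 = (m - 1) / 2 + 1 := by omega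
      rw [hq, add_mul, one_mul, add_assoc, Nat.sub_add_cancel (by omega : 3 ≤ k), add_comm]
  -- `c₁ |cdM_3(T)| = C(k,3) |cdM_k(T)|`
  have hdc : ∀ lab ∈ partitions n m k, c₁ * (cdMatchings lab 3).card = (cdMatchings lab k).card * k.choose 3 := by
    intro lab hlab
    have := sum_card_kext lab k 3
    rw [sum_const_nat fun H hH => hc₁ lab hlab H hH] at this
    rw [mul_comm] at this
    exact this
  -- hence `c₁ |Ω_3| = C(k,3) c₃ |Ω_k|`
  have hΩrel : (c₁ : ℝ) * (Omega n m k ((m + 1) / 2 * (k - 3) + 3) 3).card =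
      (k.choose 3 : ℝ) * c₃ * (Omega n m k ((m + 1) / 2 * (k - 3) + 3) k).card := by
    rw [hΩ3, hΩk]
    push_cast
    rw [mul_sum, mul_sum]
    refine sum_congr rfl fun lab hlab => ?_
    have h := hdc lab hlab
    have h' : (c₁ : ℝ) * (cdMatchings lab 3).card = (cdMatchings lab k).card * k.choose 3 := by
      exact_mod_cast h
    calc (c₁ : ℝ) * ((cdMatchings lab 3).card * (u * (c₃ * wT lab)))
        = (c₁ : ℝ) * (cdMatchings lab 3).card * (u * (c₃ * wT lab)) := by ring
      _ = (cdMatchings lab k).card * k.choose 3 * (u * (c₃ * wT lab)) := by rw [h']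
      _ = (k.choose 3 : ℝ) * c₃ * ((cdMatchings lab k).card * (u * (1 * wT lab))) := by ring
  -- the per-partition inequality, summed
  have hsum : (c₁ : ℝ) * ∑ lab ∈ partitions n m k, ∑ H ∈ (cdMatchings lab 3).filter
      (fun H => GoodΩ X Y lab ((m + 1) / 2 * (k - 3) + 3) H ε), (termN ((m + 1) / 2 * (k - 3) + 3) X Y lab H : ℝ) ≤
      (1 + ε) ^ 3 * c₃ * g * ∑ lab ∈ partitions n m k, ∑ F ∈ cdMatchings lab k,
        (termN ((m + 1) / 2 * (k - 3) + 3) X Y lab F : ℝ) := by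
    rw [mul_sum, mul_sum]
    refine sum_le_sum fun lab hlab => ?_
    exact good_sum_le hlab hk hε havoid (hc₁ lab hlab)
  -- combine
  rw [hG, hRk]
  set SG := ∑ lab ∈ partitions n m k, ∑ H ∈ (cdMatchings lab 3).filter
      (fun H => GoodΩ X Y lab ((m + 1) / 2 * (k - 3) + 3) H ε), (termN ((m + 1) / 2 * (k - 3) + 3) X Y lab H : ℝ) with hSG
  set Sk := ∑ lab ∈ partitions n m k, ∑ F ∈ cdMatchings lab k, (termN ((m + 1) / 2 * (k - 3) + 3) X Y lab F : ℝ) with hSk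
  set O3 : ℝ := ((Omega n m k ((m + 1) / 2 * (k - 3) + 3) 3).card : ℝ) with hO3
  set Ok : ℝ := ((Omega n m k ((m + 1) / 2 * (k - 3) + 3) k).card : ℝ) with hOk
  have hc₁r : (0 : ℝ) < c₁ := by exact_mod_cast hc₁pos
  have hCpos : (0 : ℝ) < k.choose 3 := by exact_mod_cast Nat.choose_pos (by omega)
  have hSG0 : 0 ≤ SG := by
    rw [hSG]; exact sum_nonneg fun _ _ => sum_nonneg fun _ _ => Nat.cast_nonneg _
  have hSk0 : 0 ≤ Sk := by
    rw [hSk]; exact sum_nonneg fun _ _ => sum_nonneg fun _ _ => Nat.cast_nonneg _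
  have hO30 : 0 ≤ O3 := Nat.cast_nonneg _
  have hOk0 : 0 ≤ Ok := Nat.cast_nonneg _
  have hg0 : (0 : ℝ) ≤ (g : ℝ) := Nat.cast_nonneg _
  by_cases hc₃0 : (c₃ : ℝ) = 0
  · -- then `c₁ SG ≤ 0`, so `SG = 0`
    have h1 : (c₁ : ℝ) * SG ≤ 0 := by
      have := hsum
      rw [hc₃0, mul_zero, zero_mul, zero_mul] at this
      exact this
    have hSG : SG = 0 := le_antisymm (by nlinarith) hSG0
    rw [hSG, zero_mul]
    exact mul_nonneg (mul_nonneg (mul_nonneg (pow_nonneg (by linarith) 3)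
      (div_nonneg hg0 hCpos.le)) hSk0) hO30
  have hc₃r : (0 : ℝ) < c₃ := lt_of_le_of_ne (Nat.cast_nonneg _) (Ne.symm hc₃0)
  have hΩrel' : (k.choose 3 : ℝ) * c₃ * Ok = c₁ * O3 := hΩrel.symm
  have key : ((c₁ : ℝ) * (k.choose 3) * c₃) * (SG * Ok) ≤
      ((c₁ : ℝ) * (k.choose 3) * c₃) * ((1 + ε) ^ 3 * ((g : ℕ) / (k.choose 3 : ℝ)) * Sk * O3) := by
    calc ((c₁ : ℝ) * (k.choose 3) * c₃) * (SG * Ok) = ((c₁ : ℝ) * SG) * ((k.choose 3 : ℝ) * c₃ * Ok) := by ring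
      _ ≤ ((1 + ε) ^ 3 * c₃ * g * Sk) * ((k.choose 3 : ℝ) * c₃ * Ok) :=
          mul_le_mul_of_nonneg_right hsum (mul_nonneg (mul_nonneg hCpos.le hc₃r.le) hOk0)
      _ = ((1 + ε) ^ 3 * c₃ * g * Sk) * (c₁ * O3) := by rw [hΩrel']
      _ = ((1 + ε) ^ 3 * c₃ * g * Sk) * (c₁ * O3) * ((k.choose 3 : ℝ) * (k.choose 3 : ℝ)⁻¹) := by
          rw [mul_inv_cancel₀ hCpos.ne', mul_one]
      _ = ((c₁ : ℝ) * (k.choose 3) * c₃) * ((1 + ε) ^ 3 * ((g : ℕ) / (k.choose 3 : ℝ)) * Sk * O3) := by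
          rw [div_eq_mul_inv]; ring
  exact le_of_mul_le_mul_left key (mul_pos (mul_pos hc₁r hCpos) hc₃r)

end Global

end Literature.Barriers.PneNP
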